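import Summits.RiemannHypothesis.RiemannHypothesis.Theorems.JensenLogBandCanarySound
import Summits.RiemannHypothesis.RiemannHypothesis.Theorems.JensenLogBandCanaryCertRows

/-!
# E-CANARY-128 — D3 file 9/9a: the certificate checked by `native_decide` (COMPUTATIONAL)

RH-FREE; evidence class of the TABLE crux packaging (`…XiGorttwCoeffSmallTable`, axiom `Lean.ofReduceBool`).
The rehearsal certificate of record (cell rh-jensen, eng g8, kit j268994; `HOME/eng/g8/ECANARY-D1.md`): rectangle
`K = [−45018, 0] × [−44600, 44600]`, upper half-boundary = LEFT edge `x = −45018`, `y ∈ [0, 44600]` (202 pieces),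
TOP edge `y = 44600`, `x ∈ [−45018, 0]` (180 pieces), RIGHT edge = imaginary axis `x = 0`, `y ∈ [0, 44600]`
(216 pieces); 45 axis sign points. Each piece row is `(a, b, L, d, K, N, xbar, U, V)`: centre `(a + b·I)/2`, length `L`,
quarter label `d` (anchor `I^d`), Taylor order `K`, truncation index `N`, radius bound `xbar`, units `2^U`/`2^V`;
Taylor-tail length `J = 60`, `r`-table reach `nmax = 800`. Each axis row is `(a, d, N, xbar, U)` (point `a/2`).
MAIN RESULTS: `checkEdge … = true` by `native_decide` for the three edges and the axis, hence (`…CanarySound`)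
`PieceIneq` / `AxisIneq` for every row under `RatioEncloses xiRatioBoxHi128 xiTaylorCoeffFrom128`.
Nothing here bears on the truth of RH.
-/

-- D-0017: the doubled namespace is by design.
set_option linter.dupNamespace false
set_option autoImplicit false

namespace Summit.RiemannHypothesis.RiemannHypothesis.Theorems.JensenPolynomials.LogBand.Canary

open Summit.RiemannHypothesis.RiemannHypothesis.Theorems.JensenPolynomials.CoeffTable (Iv lk RatioEncloses)

/-- Taylor-tail length of the certificate. -/
def certJ : ℕ := 60
/-- Reach of the `r`-table of the certificate. -/
def certNmax : ℕ := 800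

/-- Row accessors of a flat piece table (9 integers per row). -/
def rowA (t : Array ℤ) (i : ℕ) : ℤ := t.getD (9 * i) 0
/-- see `rowA` -/ def rowB (t : Array ℤ) (i : ℕ) : ℤ := t.getD (9 * i + 1) 0
/-- see `rowA` -/ def rowL (t : Array ℤ) (i : ℕ) : ℕ := (t.getD (9 * i + 2) 0).toNat
/-- see `rowA` -/ def rowD (t : Array ℤ) (i : ℕ) : ℕ := (t.getD (9 * i + 3) 0).toNat
/-- see `rowA` -/ def rowK (t : Array ℤ) (i : ℕ) : ℕ := (t.getD (9 * i + 4) 0).toNat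
/-- see `rowA` -/ def rowN (t : Array ℤ) (i : ℕ) : ℕ := (t.getD (9 * i + 5) 0).toNat
/-- see `rowA` -/ def rowX (t : Array ℤ) (i : ℕ) : ℕ := (t.getD (9 * i + 6) 0).toNat
/-- see `rowA` -/ def rowU (t : Array ℤ) (i : ℕ) : ℤ := t.getD (9 * i + 7) 0
/-- see `rowA` -/ def rowV (t : Array ℤ) (i : ℕ) : ℤ := t.getD (9 * i + 8) 0

/-- Run `checkPiece` on rows `0 … n−1` of a flat piece table. -/
def checkEdge (box : List Iv) (nmax : ℕ) (rb : Array FI) (t : Array ℤ) (n J : ℕ) : Bool :=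
  (List.range n).all fun i =>
    checkPiece box nmax rb (rowA t i) (rowB t i) (rowL t i) (rowD t i) (rowK t i) (rowN t i) J (rowX t i) (rowU t i) (rowV t i)

/-- `checkEdge = true` gives `PieceIneq` for every row. -/
theorem pieceIneq_of_checkEdge {box : List Iv} {nmax : ℕ} (hbox : RatioEncloses box xiTaylorCoeffFrom128)
    (hlen : nmax < box.length) {t : Array ℤ} {n J : ℕ} (h : checkEdge box nmax (rbArr box nmax) t n J = true)
    {i : ℕ} (hi : i < n) : PieceIneq (rowA t i) (rowB t i) (rowL t i) (rowD t i) (rowK t i) (rowN t i) J (rowX t i) := by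
  unfold checkEdge at h
  rw [List.all_eq_true] at h
  exact pieceIneq_of_checkPiece hbox hlen (h i (List.mem_range.2 hi))

/-- Row accessors of a flat axis table (5 integers per row). -/
def axA (t : Array ℤ) (i : ℕ) : ℤ := t.getD (5 * i) 0
/-- see `axA` -/ def axD (t : Array ℤ) (i : ℕ) : ℕ := (t.getD (5 * i + 1) 0).toNat
/-- see `axA` -/ def axN (t : Array ℤ) (i : ℕ) : ℕ := (t.getD (5 * i + 2) 0).toNat
/-- see `axA` -/ def axX (t : Array ℤ) (i : ℕ) : ℕ := (t.getD (5 * i + 3) 0).toNat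
/-- see `axA` -/ def axU (t : Array ℤ) (i : ℕ) : ℤ := t.getD (5 * i + 4) 0

/-- Run `checkAxis` on rows `0 … n−1` of a flat axis table. -/
def checkAxisTable (box : List Iv) (nmax : ℕ) (rb : Array FI) (t : Array ℤ) (n : ℕ) : Bool :=
  (List.range n).all fun i => checkAxis box nmax rb (axA t i) (axD t i) (axN t i) (axX t i) (axU t i)

/-- `checkAxisTable = true` gives `AxisIneq` for every row. -/
theorem axisIneq_of_checkAxisTable {box : List Iv} {nmax : ℕ} (hbox : RatioEncloses box xiTaylorCoeffFrom128)
    (hlen : nmax < box.length) {t : Array ℤ} {n : ℕ} (h : checkAxisTable box nmax (rbArr box nmax) t n = true)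
    {i : ℕ} (hi : i < n) : AxisIneq (axA t i) (axD t i) (axN t i) (axX t i) := by
  unfold checkAxisTable at h
  rw [List.all_eq_true] at h
  exact axisIneq_of_checkAxis hbox hlen (h i (List.mem_range.2 hi))

/-! ## Evaluation (computational: `Lean.ofReduceBool`) -/

/-- The LEFT edge rows pass the piece checker. -/
theorem checkEdge_left : checkEdge xiRatioBoxHi128 certNmax (rbArr xiRatioBoxHi128 certNmax) leftRows leftCount certJ = true := by
  native_decide

/-- The TOP edge rows pass the piece checker. -/
theorem checkEdge_top : checkEdge xiRatioBoxHi128 certNmax (rbArr xiRatioBoxHi128 certNmax) topRows topCount certJ = true := by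
  native_decide

/-- The imaginary-axis rows pass the piece checker. -/
theorem checkEdge_imag : checkEdge xiRatioBoxHi128 certNmax (rbArr xiRatioBoxHi128 certNmax) imagRows imagCount certJ = true := by
  native_decide

/-- The axis rows pass the axis checker. -/
theorem checkAxis_rows : checkAxisTable xiRatioBoxHi128 certNmax (rbArr xiRatioBoxHi128 certNmax) axisRows axisCount = true := by
  native_decide

/-- The data box has `1024 > certNmax` entries. -/
theorem certNmax_lt_length : certNmax < xiRatioBoxHi128.length := by
  native_decide

/-! ## Consequences under the enclosure hypothesis -/

/-- `PieceIneq` for every LEFT row. -/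
theorem left_pieceIneq (hbox : RatioEncloses xiRatioBoxHi128 xiTaylorCoeffFrom128) {i : ℕ} (hi : i < leftCount) :
    PieceIneq (rowA leftRows i) (rowB leftRows i) (rowL leftRows i) (rowD leftRows i) (rowK leftRows i)
      (rowN leftRows i) certJ (rowX leftRows i) :=
  pieceIneq_of_checkEdge hbox certNmax_lt_length checkEdge_left hi

/-- `PieceIneq` for every TOP row. -/
theorem top_pieceIneq (hbox : RatioEncloses xiRatioBoxHi128 xiTaylorCoeffFrom128) {i : ℕ} (hi : i < topCount) :
    PieceIneq (rowA topRows i) (rowB topRows i) (rowL topRows i) (rowD topRows i) (rowK topRows i)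
      (rowN topRows i) certJ (rowX topRows i) :=
  pieceIneq_of_checkEdge hbox certNmax_lt_length checkEdge_top hi

/-- `PieceIneq` for every imaginary-axis row. -/
theorem imag_pieceIneq (hbox : RatioEncloses xiRatioBoxHi128 xiTaylorCoeffFrom128) {i : ℕ} (hi : i < imagCount) :
    PieceIneq (rowA imagRows i) (rowB imagRows i) (rowL imagRows i) (rowD imagRows i) (rowK imagRows i)
      (rowN imagRows i) certJ (rowX imagRows i) :=
  pieceIneq_of_checkEdge hbox certNmax_lt_length checkEdge_imag hi

/-- `AxisIneq` for every axis row. -/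
theorem axis_axisIneq (hbox : RatioEncloses xiRatioBoxHi128 xiTaylorCoeffFrom128) {i : ℕ} (hi : i < axisCount) :
    AxisIneq (axA axisRows i) (axD axisRows i) (axN axisRows i) (axX axisRows i) :=
  axisIneq_of_checkAxisTable hbox certNmax_lt_length checkAxis_rows hi

end Summit.RiemannHypothesis.RiemannHypothesis.Theorems.JensenPolynomials.LogBand.Canary
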